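import Mathlib.NumberTheory.Height.NumberField
import Mathlib.FieldTheory.IntermediateField.Adjoin.Basic
import Mathlib.RingTheory.MvPolynomial.Basic
import Literature.NumberTheory.Transcendental.QuadraticRelationsLogarithmsMahlerWeil
import Literature.NumberTheory.Transcendental.RoySmallValueEstimatesAbsHeightProofs
import Summits.Schanuel.Schanuel.Theorems.DiophantineDichotomyApproximationPropertyLiftHeights

/-!
# Lifting step for the approximation property — degrees and naive heights (stub `stub_lift`, part 3)

Route `DiophantineDichotomy`, crux `ApproximationProperty` (stmt-Schanuel-6117), line
`orbit-interpolation-determinant`, registered stub `stub_lift`.  Algebraic bookkeeping for the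
lifted tuple `γ`: each `γ i ∈ ℂ` is a root of `qᵢ^σ` for a non-zero polynomial `qᵢ` over a
number field `K` embedded by `σ : K → ℂ`.

* `map_map_aeval` — naturality of specialising `P ∈ ℚ[x][y]` at `β ∈ Kᵗ` and then embedding;
* `isIntegral_of_isRoot_map` — such a root is algebraic over `ℚ`;
* `finrank_adjoin_le_of_isRoot_map` — TOWER LAW: `[ℚ(γ) : ℚ] ≤ [K : ℚ] · ∏ᵢ deg qᵢ`
  (`ℚ(γ) ⊆ σ(K)(γ)`, `[σ(K)(γ) : σ(K)] ≤ ∏ [σ(K)(γᵢ) : σ(K)] ≤ ∏ deg qᵢ`);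
* `natDegree_minpoly_le_finrank_adjoin` — `deg_ℚ γᵢ ≤ [ℚ(γ) : ℚ]`;
* `exists_intPoly_coeff_le` — FROM THE WEIL HEIGHT TO AN INTEGER POLYNOMIAL: an algebraic `α ∈ ℂ`
  of degree `n` is a root of a non-zero `P ∈ ℤ[X]` of degree `n` with all
  `|coeff| ≤ 2ⁿ exp(n h(α))` (primitive irreducible integer minimal polynomial, `log M(P) = n h(α)`
  by the tree's Mahler–Weil identity `MahlerWeil.weilHeight₁_root_eq`, `|Pₖ| ≤ C(n,k) M(P)`);
* `exists_intPoly_of_isRoot_map` — the NAIVE HEIGHT OF A LIFTED COORDINATE: the three height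
  steps combined for a complex root of `q^σ`, `q ∈ K[X]`.

No new definitions; every theorem is proved.  Sources: BombieriGubler2006 §1.5–1.6; folklore
(Lang, *Algebra*, Ch. V §1).
-/

-- `Summit.Schanuel.Schanuel.…` is the mandated summit/sub-problem namespace (single-conjunct summit), hence:
set_option linter.dupNamespace false

namespace Summit.Schanuel.Schanuel.Cruxes.ApproximationProperty.OrbitInterpolationDeterminant

open Polynomial
open Literature.NumberTheory.Transcendental

noncomputable section

/-! ## Naturality of specialisation -/

/-- Specialising the coefficients of `P ∈ ℚ[x₁, …, xₙ][y]` at `β ∈ Kⁿ` and then applying a ring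
homomorphism `f : K → L` is specialising at `f ∘ β`. [folklore] -/
theorem map_map_aeval {n : ℕ} {K L : Type*} [Field K] [Field L] [Algebra ℚ K] [Algebra ℚ L]
    (f : K →+* L) (β : Fin n → K) (P : Polynomial (MvPolynomial (Fin n) ℚ)) :
    (P.map (MvPolynomial.aeval β).toRingHom).map f =
      P.map (MvPolynomial.aeval (fun j => f (β j))).toRingHom := by
  rw [Polynomial.map_map]
  congr 1
  have h := MvPolynomial.comp_aeval β f.toRatAlgHom
  apply RingHom.ext
  intro p
  have hp := congrArg (fun g : MvPolynomial (Fin n) ℚ →ₐ[ℚ] L => g p) h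
  simpa using hp

/-! ## Integrality of the lifted coordinates -/

/-- The image `σ(K) ⊂ ℂ` of a number field is finite-dimensional over `ℚ`. [folklore] -/
theorem finiteDimensional_fieldRange {K : Type*} [Field K] [NumberField K] (σ : K →+* ℂ) :
    FiniteDimensional ℚ ↥(σ.toRatAlgHom).fieldRange :=
  LinearEquiv.finiteDimensional (AlgEquiv.ofInjectiveField σ.toRatAlgHom).toLinearEquiv

/-- `[σ(K) : ℚ] = [K : ℚ]`. [folklore] -/
theorem finrank_fieldRange {K : Type*} [Field K] [NumberField K] (σ : K →+* ℂ) :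
    Module.finrank ℚ ↥(σ.toRatAlgHom).fieldRange = Module.finrank ℚ K :=
  (LinearEquiv.finrank_eq (AlgEquiv.ofInjectiveField σ.toRatAlgHom).toLinearEquiv).symm

/-- A complex root of `q^σ`, for a non-zero `q` over a number field `K` embedded by `σ`, is
integral over the image field `σ(K)`, with minimal polynomial of degree `≤ deg q`. [folklore] -/
theorem isIntegral_fieldRange_of_isRoot_map {K : Type*} [Field K] [NumberField K] (σ : K →+* ℂ)
    {q : K[X]} (hq : q ≠ 0) {α : ℂ} (hα : (q.map σ).IsRoot α) :
    IsIntegral ↥(σ.toRatAlgHom).fieldRange α ∧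
      (minpoly ↥(σ.toRatAlgHom).fieldRange α).natDegree ≤ q.natDegree := by
  set K' : IntermediateField ℚ ℂ := (σ.toRatAlgHom).fieldRange with hK'
  have hmem : ∀ y : K, σ y ∈ K' := fun y => AlgHom.mem_fieldRange.mpr ⟨y, rfl⟩
  set ρ : K →+* K' := σ.codRestrict K' hmem with hρ
  set q' : K'[X] := q.map ρ with hq'
  have hq'0 : q' ≠ 0 := (Polynomial.map_ne_zero_iff ρ.injective).mpr hq
  have hcomp : (algebraMap K' ℂ).comp ρ = σ := RingHom.ext fun _ => rfl
  have haeval : aeval α q' = 0 := by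
    rw [aeval_def, hq', eval₂_map, hcomp, ← eval_map]
    exact hα
  have hint : IsIntegral K' α := (isAlgebraic_iff_isIntegral).mp ⟨q', hq'0, haeval⟩
  refine ⟨hint, ?_⟩
  calc (minpoly K' α).natDegree ≤ q'.natDegree :=
        Polynomial.natDegree_le_natDegree (minpoly.degree_le_of_ne_zero K' α hq'0 haeval)
    _ ≤ q.natDegree := natDegree_map_le

/-- A complex root of `q^σ` (`q ≠ 0` over a number field `K` embedded by `σ`) is algebraic
over `ℚ`. [folklore] -/
theorem isIntegral_of_isRoot_map {K : Type*} [Field K] [NumberField K] (σ : K →+* ℂ)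
    {q : K[X]} (hq : q ≠ 0) {α : ℂ} (hα : (q.map σ).IsRoot α) : IsIntegral ℚ α := by
  haveI := finiteDimensional_fieldRange σ
  exact isIntegral_trans α (isIntegral_fieldRange_of_isRoot_map σ hq hα).1

/-! ## The tower law for the lifted tuple -/

/-- **Degree of the lifted tuple.** If every `γ i` is a root of `qᵢ^σ` for non-zero `qᵢ ∈ K[X]`
of degree `≤ eᵢ`, `K` a number field embedded by `σ : K → ℂ`, then
`[ℚ(γ) : ℚ] ≤ [K : ℚ] · ∏ᵢ eᵢ`. [folklore] -/
theorem finrank_adjoin_le_of_isRoot_map {K : Type*} [Field K] [NumberField K] (σ : K →+* ℂ)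
    {ι : Type} [Fintype ι] (γ : ι → ℂ) (q : ι → K[X]) (hq : ∀ i, q i ≠ 0)
    (hroot : ∀ i, ((q i).map σ).IsRoot (γ i)) (e : ι → ℕ) (he : ∀ i, (q i).natDegree ≤ e i) :
    Module.finrank ℚ ↥(IntermediateField.adjoin ℚ (Set.range γ)) ≤
      Module.finrank ℚ K * ∏ i, e i := by
  classical
  set K' : IntermediateField ℚ ℂ := (σ.toRatAlgHom).fieldRange with hK'
  haveI : FiniteDimensional ℚ K' := finiteDimensional_fieldRange σ
  have hint : ∀ i, IsIntegral K' (γ i) := fun i => (isIntegral_fieldRange_of_isRoot_map σ (hq i) (hroot i)).1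
  have hdeg : ∀ i, Module.finrank K' ↥(IntermediateField.adjoin K' {γ i}) ≤ e i := fun i => by
    rw [IntermediateField.adjoin.finrank (hint i)]
    exact (isIntegral_fieldRange_of_isRoot_map σ (hq i) (hroot i)).2.trans (he i)
  -- `[K'(γ) : K'] ≤ ∏ eᵢ`, by induction on the number of adjoined coordinates
  have hind : ∀ s : Finset ι,
      Module.finrank K' ↥(IntermediateField.adjoin K' (γ '' (s : Set ι))) ≤ ∏ i ∈ s, e i := by
    intro s
    induction s using Finset.induction_on with
    | empty =>
      rw [Finset.coe_empty, Set.image_empty, IntermediateField.adjoin_empty,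
        IntermediateField.finrank_bot, Finset.prod_empty]
    | insert a s has ih =>
      rw [Finset.coe_insert, Set.image_insert_eq, Set.insert_eq, IntermediateField.adjoin_union,
        Finset.prod_insert has]
      exact (IntermediateField.finrank_sup_le _ _).trans (Nat.mul_le_mul (hdeg a) ih)
  set M : IntermediateField K' ℂ := IntermediateField.adjoin K' (Set.range γ) with hM
  have hMle : Module.finrank K' M ≤ ∏ i, e i := by
    have h := hind Finset.univ
    rwa [Finset.coe_univ, Set.image_univ] at h
  haveI hMfin : FiniteDimensional K' M :=
    IntermediateField.finiteDimensional_adjoin fun x hx => by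
      obtain ⟨i, rfl⟩ := hx
      exact hint i
  haveI : Module.Finite ℚ M := Module.Finite.trans K' M
  -- `ℚ(γ) ⊆ K'(γ)` as `ℚ`-vector spaces
  have hsub : ∀ x : ℂ, x ∈ IntermediateField.adjoin ℚ (Set.range γ) → x ∈ M := by
    have hle : IntermediateField.adjoin ℚ (Set.range γ) ≤ M.restrictScalars ℚ :=
      IntermediateField.adjoin_le_iff.mpr (IntermediateField.subset_adjoin K' (Set.range γ))
    intro x hx
    exact hle hx
  set f : ↥(IntermediateField.adjoin ℚ (Set.range γ)) →ₗ[ℚ] ↥M :=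
    { toFun := fun x => ⟨x, hsub x x.2⟩
      map_add' := fun x y => rfl
      map_smul' := fun c x => rfl } with hf
  have hfinj : Function.Injective f := by
    intro x y hxy
    apply Subtype.ext
    have := congrArg Subtype.val hxy
    exact this
  calc Module.finrank ℚ ↥(IntermediateField.adjoin ℚ (Set.range γ)) ≤ Module.finrank ℚ M :=
        LinearMap.finrank_le_finrank_of_injective hfinj
    _ = Module.finrank ℚ K' * Module.finrank K' M := (Module.finrank_mul_finrank ℚ K' M).symm
    _ ≤ Module.finrank ℚ K * ∏ i, e i := by
        rw [finrank_fieldRange σ]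
        exact Nat.mul_le_mul_left _ hMle

/-- `deg_ℚ (γ i) ≤ [ℚ(γ) : ℚ]` for a tuple of algebraic numbers. [folklore] -/
theorem natDegree_minpoly_le_finrank_adjoin {ι : Type} [Fintype ι] (γ : ι → ℂ)
    (hγ : ∀ i, IsIntegral ℚ (γ i)) (i : ι) :
    (minpoly ℚ (γ i)).natDegree ≤ Module.finrank ℚ ↥(IntermediateField.adjoin ℚ (Set.range γ)) := by
  set L := IntermediateField.adjoin ℚ (Set.range γ) with hL
  haveI : FiniteDimensional ℚ L :=
    IntermediateField.finiteDimensional_adjoin fun x hx => by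
      obtain ⟨j, rfl⟩ := hx
      exact hγ j
  set x : L := ⟨γ i, IntermediateField.subset_adjoin ℚ _ ⟨i, rfl⟩⟩ with hx
  have hmin : minpoly ℚ x = minpoly ℚ (γ i) :=
    (minpoly.algHom_eq L.val Subtype.val_injective x).symm
  rw [← hmin]
  exact minpoly.natDegree_le x

/-! ## From the Weil height to an integer polynomial with small coefficients -/

-- adapted from `…KhovanskiiApproxType.LwSmallHeight.TransferOfSiegel.exists_irreducible_factor_aeval_eq_zero`
/-- A non-zero integer polynomial vanishing at `z ∈ ℂ` has an irreducible factor of positive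
degree vanishing at `z`. [folklore] -/
theorem exists_irreducible_factor_aeval_eq_zero (z : ℂ) (P : ℤ[X]) :
    P ≠ 0 → aeval z P = 0 → ∃ f : ℤ[X], Irreducible f ∧ f ∣ P ∧ 0 < f.natDegree ∧ aeval z f = 0 := by
  induction P using WfDvdMonoid.induction_on_irreducible with
  | zero => intro h; exact absurd rfl h
  | unit u hu =>
    intro _ hz
    exfalso
    obtain ⟨r, hr, rfl⟩ := Polynomial.isUnit_iff.1 hu
    rw [aeval_C, algebraMap_int_eq, eq_intCast, Int.cast_eq_zero] at hz
    exact hr.ne_zero hz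
  | mul a i ha hi ih =>
    intro _ hz
    rw [map_mul, mul_eq_zero] at hz
    rcases hz with hzi | hza
    · refine ⟨i, hi, dvd_mul_right i a, ?_, hzi⟩
      exact natDegree_pos_of_aeval_root hi.ne_zero hzi fun x hx => by
        rwa [algebraMap_int_eq, eq_intCast, Int.cast_eq_zero] at hx
    · obtain ⟨f, hf, hfa, hdeg, hfz⟩ := ih ha hza
      exact ⟨f, hf, hfa.trans (dvd_mul_left a i), hdeg, hfz⟩

-- adapted from `…KhovanskiiApproxType.LwSmallHeight.TransferOfSiegel.natDegree_minpoly_eq_of_irreducible`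
/-- The degree of the minimal polynomial over `ℚ` of a root of an irreducible integer polynomial
of positive degree is the degree of that polynomial (Gauss's lemma). [folklore] -/
theorem natDegree_minpoly_eq_of_irreducible (z : ℂ) (f : ℤ[X]) (hf : Irreducible f)
    (hdeg : 0 < f.natDegree) (hz : aeval z f = 0) : (minpoly ℚ z).natDegree = f.natDegree := by
  have hprim : f.IsPrimitive := hf.isPrimitive hdeg.ne'
  have hirrQ : Irreducible (f.map (Int.castRingHom ℚ)) :=
    (IsPrimitive.Int.irreducible_iff_irreducible_map_cast hprim).1 hf
  have hzQ : aeval z (f.map (Int.castRingHom ℚ)) = 0 := by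
    rw [← algebraMap_int_eq, aeval_map_algebraMap]; exact hz
  have key := minpoly.eq_of_irreducible hirrQ hzQ
  rw [← key, natDegree_mul_C, natDegree_map_eq_of_injective (Int.castRingHom ℚ).injective_int]
  exact inv_ne_zero (leadingCoeff_ne_zero.2 hirrQ.ne_zero)

/-- **From the Weil height to naive heights.** An algebraic `α ∈ ℂ`, lying in the number field
`F ⊂ ℂ`, of degree `n` over `ℚ`, is a root of a non-zero `P ∈ ℤ[X]` of degree `n` all of whose
coefficients satisfy `|Pₖ| ≤ 2ⁿ · exp(n · h(α))`, `h` the absolute logarithmic Weil height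
(`P` = the primitive irreducible integer minimal polynomial: `log M(P) = n h(α)` and
`|Pₖ| ≤ C(n,k) M(P) ≤ 2ⁿ M(P)`). [folklore] -/
theorem exists_intPoly_coeff_le (F : IntermediateField ℚ ℂ) [FiniteDimensional ℚ F] {α : ℂ}
    (hα : α ∈ F) :
    ∃ P : ℤ[X], P ≠ 0 ∧ aeval α P = 0 ∧ P.natDegree = (minpoly ℚ α).natDegree ∧
      ∀ k, (|P.coeff k| : ℝ) ≤
        2 ^ P.natDegree * Real.exp (P.natDegree * weilHeight₁ F (fun _ : Unit => α)) := by
  -- `α` is algebraic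
  have hint : IsIntegral ℚ α := by
    have h := (Algebra.IsIntegral.isIntegral (R := ℚ) (⟨α, hα⟩ : F)).map (IntermediateField.val F)
    exact h
  have halgZ : IsAlgebraic ℤ α := (IsFractionRing.isAlgebraic_iff ℤ ℚ ℂ).mpr hint.isAlgebraic
  obtain ⟨P₀, hP₀0, hP₀α⟩ := halgZ
  obtain ⟨f, hf, -, hdeg, hfz⟩ := exists_irreducible_factor_aeval_eq_zero α P₀ hP₀0 hP₀α
  have hmin := natDegree_minpoly_eq_of_irreducible α f hf hdeg hfz
  refine ⟨f, hf.ne_zero, hfz, hmin.symm, fun k => ?_⟩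
  -- Mahler measure = height
  have hroot := RoyWaldschmidt1997.MahlerWeil.weilHeight₁_root_eq f hf hdeg hfz F hα
  set fC := f.map (Int.castRingHom ℂ) with hfC
  have hfC0 : fC ≠ 0 := (Polynomial.map_ne_zero_iff (Int.castRingHom ℂ).injective_int).mpr hf.ne_zero
  have hM0 : 0 < fC.mahlerMeasure := mahlerMeasure_pos_of_ne_zero hfC0
  have hnatC : fC.natDegree = f.natDegree :=
    natDegree_map_eq_of_injective (Int.castRingHom ℂ).injective_int f
  have hn0 : (0 : ℝ) < f.natDegree := by exact_mod_cast hdeg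
  have hlogM : Real.log fC.mahlerMeasure = f.natDegree * weilHeight₁ F (fun _ : Unit => α) := by
    rw [hroot, mul_div_cancel₀ _ hn0.ne']
  have hcoeff : (|f.coeff k| : ℝ) = ‖fC.coeff k‖ := by
    rw [hfC, coeff_map, eq_intCast, Complex.norm_intCast]
  rw [hcoeff]
  calc ‖fC.coeff k‖ ≤ (fC.natDegree.choose k : ℝ) * fC.mahlerMeasure :=
        norm_coeff_le_choose_mul_mahlerMeasure k fC
    _ ≤ (2 : ℝ) ^ f.natDegree * fC.mahlerMeasure := by
        apply mul_le_mul_of_nonneg_right _ hM0.le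
        rw [hnatC]
        exact_mod_cast Nat.choose_le_two_pow f.natDegree k
    _ = 2 ^ f.natDegree * Real.exp (f.natDegree * weilHeight₁ F (fun _ : Unit => α)) := by
        rw [← hlogM, Real.exp_log hM0]

/-! ## The integer polynomial of a lifted coordinate -/

/-- **The naive height of a lifted coordinate.** Let `K` be a number field, `σ : K → ℂ`,
`q ∈ K[X]` non-zero of degree `≤ e`, and `α ∈ ℂ` a root of `q^σ`.  Then `α` is a root of a
non-zero `P ∈ ℤ[X]` of degree `deg_ℚ α` all of whose coefficients satisfy
`|Pₖ| ≤ (2 (e+1) exp(h_K(q₀ : ⋯ : qₑ)/[K:ℚ]))^{deg P}` (height of a root, invariance of the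
absolute height under `σ`, and the Mahler–Weil identity). [folklore] -/
theorem exists_intPoly_of_isRoot_map {K : Type*} [Field K] [NumberField K] (σ : K →+* ℂ)
    {q : K[X]} (hq : q ≠ 0) {α : ℂ} (hα : (q.map σ).IsRoot α) {e : ℕ} (he : q.natDegree ≤ e) :
    ∃ P : ℤ[X], P ≠ 0 ∧ aeval α P = 0 ∧ P.natDegree = (minpoly ℚ α).natDegree ∧
      ∀ k, (|P.coeff k| : ℝ) ≤
        (2 * ((e : ℝ) + 1) * Real.exp (Height.logHeight (fun k : Fin (e + 1) => q.coeff k) /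
          Module.finrank ℚ K)) ^ P.natDegree := by
  classical
  set K' : IntermediateField ℚ ℂ := (σ.toRatAlgHom).fieldRange with hK'
  haveI : FiniteDimensional ℚ K' := finiteDimensional_fieldRange σ
  have hint : IsIntegral ℚ α := isIntegral_of_isRoot_map σ hq hα
  haveI : FiniteDimensional ℚ ↥(IntermediateField.adjoin ℚ {α}) :=
    IntermediateField.adjoin.finiteDimensional hint
  set F : IntermediateField ℚ ℂ := K' ⊔ IntermediateField.adjoin ℚ {α} with hF
  haveI : FiniteDimensional ℚ F := IntermediateField.finiteDimensional_sup _ _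
  haveI : NumberField F := numberField_of_intermediateField F
  have hKF : ∀ y : K, σ y ∈ F := fun y =>
    (le_sup_left : K' ≤ F) (AlgHom.mem_fieldRange.mpr ⟨y, rfl⟩)
  have hαF : α ∈ F :=
    (le_sup_right : IntermediateField.adjoin ℚ {α} ≤ F) (IntermediateField.mem_adjoin_simple_self ℚ α)
  set τ : K →+* F := σ.codRestrict F hKF with hτ
  set x : F := ⟨α, hαF⟩ with hx
  set qF : F[X] := q.map τ with hqF
  have hqF0 : qF ≠ 0 := (Polynomial.map_ne_zero_iff τ.injective).mpr hq
  have hdegF : qF.natDegree ≤ e := (natDegree_map_le).trans he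
  have hcomp : (algebraMap F ℂ).comp τ = σ := RingHom.ext fun _ => rfl
  have hroot : qF.IsRoot x := by
    have hinj : Function.Injective (algebraMap F ℂ) := (algebraMap F ℂ).injective
    rw [IsRoot, ← map_eq_zero_iff _ hinj, hqF, eval_map, Polynomial.hom_eval₂, hcomp, ← eval_map]
    exact hα
  -- height of the root in `F`
  have h1 := logHeight₁_le_of_isRoot hqF0 hroot hdegF
  have hcoeffs : (fun k : Fin (e + 1) => qF.coeff k) = fun k : Fin (e + 1) => τ (q.coeff k) := by
    funext k
    rw [hqF, coeff_map]
  rw [hcoeffs] at h1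
  have h2 := NguyenRoy.logHeight_comp_div_finrank τ (fun k : Fin (e + 1) => q.coeff k)
  have hFpos : (0 : ℝ) < Module.finrank ℚ F := by exact_mod_cast Module.finrank_pos
  set hq' : ℝ := Height.logHeight (fun k : Fin (e + 1) => q.coeff k) / Module.finrank ℚ K with hhq'
  have h3 : Height.logHeight₁ x / Module.finrank ℚ F ≤ Real.log ((e : ℝ) + 1) + hq' := by
    rw [← h2, div_le_iff₀ hFpos, add_mul, div_mul_cancel₀ _ hFpos.ne']
    linarith
  -- the Mahler–Weil step
  have hw : weilHeight₁ F (fun _ : Unit => α) = Height.logHeight₁ x / Module.finrank ℚ F :=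
    weilHeight₁_single_eq F hαF
  obtain ⟨P, hP0, hPα, hPdeg, hPcoeff⟩ := exists_intPoly_coeff_le F hαF
  refine ⟨P, hP0, hPα, hPdeg, fun k => (hPcoeff k).trans ?_⟩
  rw [hw]
  have he0 : (0 : ℝ) < (e : ℝ) + 1 := by positivity
  calc (2 : ℝ) ^ P.natDegree * Real.exp (P.natDegree * (Height.logHeight₁ x / Module.finrank ℚ F))
      ≤ 2 ^ P.natDegree * Real.exp (P.natDegree * (Real.log ((e : ℝ) + 1) + hq')) := by
        gcongr
    _ = (2 * ((e : ℝ) + 1) * Real.exp hq') ^ P.natDegree := by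
        rw [Real.exp_nat_mul, Real.exp_add, Real.exp_log he0, ← mul_pow, mul_assoc]

/-! ## The algebraic case `trdeg ℚ(θ) = 0` -/

-- adapted from `Summit.Schanuel.Schanuel.Cruxes.ApproximationProperty.Disproof.apAt_of_forall_isAlgebraic`
/-- At a point all of whose coordinates are ALGEBRAIC the conclusion of the crux (`APAt θ t`,
unfolded) holds for every `t ≥ 1`, with `γ = θ` itself (re-proved from the standing disprover's
`Disproof.lean §4 apAt_of_forall_isAlgebraic`, which is not importable). -/
theorem apDatum_of_forall_isAlgebraic {ι : Type} [Fintype ι] (θ : ι → ℂ)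
    (hθ : ∀ i, IsAlgebraic ℚ (θ i)) {t : ℕ} (ht : 1 ≤ t) :
    ∃ c : ℝ, 1 ≤ c ∧ ∀ Δ Y : ℝ, c ≤ Δ → Δ ≤ Y → ∃ (γ : ι → ℂ) (d H : ℕ),
      Module.finrank ℚ ↥(IntermediateField.adjoin ℚ (Set.range γ)) ≤ d ∧
      (∀ i, ∃ P : Polynomial ℤ, P ≠ 0 ∧ P.natDegree ≤ d ∧ (∀ k, |P.coeff k| ≤ (H : ℤ)) ∧
        Polynomial.aeval (γ i) P = 0) ∧
      (d : ℝ) ≤ (c * Δ) ^ t ∧ Real.log H ≤ c * Y * Δ ^ (t - 1) ∧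
      ‖γ - θ‖ ≤ Real.exp (-((Real.log H * Δ + d * Y) / c)) := by
  classical
  have hZ : ∀ i, ∃ P : ℤ[X], P ≠ 0 ∧ aeval (θ i) P = 0 := fun i =>
    (IsFractionRing.isAlgebraic_iff ℤ ℚ ℂ).mpr (hθ i)
  choose P hP0 hPθ using hZ
  set d : ℕ := Module.finrank ℚ ↥(IntermediateField.adjoin ℚ (Set.range θ)) +
    ∑ i, (P i).natDegree with hd
  set H : ℕ := ∑ i, ∑ k ∈ (P i).support, ((P i).coeff k).natAbs with hH
  have hcoeff : ∀ i k, |(P i).coeff k| ≤ (H : ℤ) := by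
    intro i k
    by_cases hk : k ∈ (P i).support
    · have h1 : ((P i).coeff k).natAbs ≤ ∑ k ∈ (P i).support, ((P i).coeff k).natAbs :=
        Finset.single_le_sum (f := fun k => ((P i).coeff k).natAbs) (fun _ _ => Nat.zero_le _) hk
      have h2 : ∑ k ∈ (P i).support, ((P i).coeff k).natAbs ≤ H :=
        Finset.single_le_sum (f := fun i => ∑ k ∈ (P i).support, ((P i).coeff k).natAbs)
          (fun _ _ => Nat.zero_le _) (Finset.mem_univ i)
      rw [Int.abs_eq_natAbs]
      exact_mod_cast h1.trans h2
    · rw [notMem_support_iff.mp hk, abs_zero]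
      positivity
  have hdeg : ∀ i, (P i).natDegree ≤ d := fun i => by
    rw [hd]
    exact le_add_left (Finset.single_le_sum (f := fun i => (P i).natDegree)
      (fun _ _ => Nat.zero_le _) (Finset.mem_univ i))
  set c : ℝ := 1 + d + Real.log H with hc
  have hlogH : 0 ≤ Real.log H := Real.log_natCast_nonneg H
  have hd0 : (0 : ℝ) ≤ d := by positivity
  have hc1 : 1 ≤ c := by rw [hc]; linarith
  refine ⟨c, hc1, fun Δ Y hΔ hY => ⟨θ, d, H, le_self_add, fun i => ⟨P i, hP0 i, hdeg i, hcoeff i,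
    hPθ i⟩, ?_, ?_, ?_⟩⟩
  · have hcΔ : 1 ≤ c * Δ := by nlinarith
    calc (d : ℝ) ≤ c := by rw [hc]; linarith
      _ ≤ c * Δ := le_mul_of_one_le_right (by linarith) (hc1.trans hΔ)
      _ ≤ (c * Δ) ^ t := le_self_pow₀ hcΔ (by omega)
  · have hΔ1 : 1 ≤ Δ := hc1.trans hΔ
    calc Real.log H ≤ c := by rw [hc]; linarith
      _ ≤ c * Y := le_mul_of_one_le_right (by linarith) (hΔ1.trans hY)
      _ ≤ c * Y * Δ ^ (t - 1) :=
          le_mul_of_one_le_right (by nlinarith) (one_le_pow₀ hΔ1)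
  · simp [(Real.exp_pos _).le]

/-! ## The registered sub-goal of this file -/

/-- REGISTERED SUB-GOAL `stub_lift_algebraic` of stub `stub_lift` (crux stmt-Schanuel-6117; this
helper file's deliverable, in the registered `∀`-chain shape): (1) the TOWER LAW for a tuple of
complex roots of polynomials over an embedded number field; (2) the INTEGER POLYNOMIAL of such a
root with coefficients controlled by the height of the coefficient vector. -/
theorem stub_lift_algebraic :
    (∀ (K : Type) [Field K] [NumberField K] (σ : K →+* ℂ) (ι : Type) [Fintype ι] (γ : ι → ℂ)
      (q : ι → Polynomial K) (e : ι → ℕ), (∀ i, q i ≠ 0) → (∀ i, ((q i).map σ).IsRoot (γ i)) →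
      (∀ i, (q i).natDegree ≤ e i) →
      Module.finrank ℚ ↥(IntermediateField.adjoin ℚ (Set.range γ)) ≤
        Module.finrank ℚ K * ∏ i, e i) ∧
    (∀ (K : Type) [Field K] [NumberField K] (σ : K →+* ℂ) (q : Polynomial K) (α : ℂ) (e : ℕ),
      q ≠ 0 → (q.map σ).IsRoot α → q.natDegree ≤ e →
      ∃ P : Polynomial ℤ, P ≠ 0 ∧ Polynomial.aeval α P = 0 ∧
        P.natDegree = (minpoly ℚ α).natDegree ∧
        ∀ k, (|P.coeff k| : ℝ) ≤ (2 * ((e : ℝ) + 1) *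
          Real.exp (Height.logHeight (fun k : Fin (e + 1) => q.coeff k) /
            Module.finrank ℚ K)) ^ P.natDegree) :=
  ⟨fun _ _ _ σ _ _ γ q e hq hroot he => finrank_adjoin_le_of_isRoot_map σ γ q hq hroot e he,
    fun _ _ _ σ _ _ _ hq hα he => exists_intPoly_of_isRoot_map σ hq hα he⟩

end

end Summit.Schanuel.Schanuel.Cruxes.ApproximationProperty.OrbitInterpolationDeterminant
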